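import Literature.NumberTheory.EllipticCurves.TorsionLocalKernelRestrictionProofs
import Literature.NumberTheory.EllipticCurves.LocalRestrictionUnramifiedDescentProofs
import Literature.NumberTheory.EllipticCurves.ArchimedeanLocalConditionTorsion
import Literature.NumberTheory.EllipticCurves.ModularityVersionApProofs
import Literature.NumberTheory.GaloisRepresentations.SplitsCompletelyCriteria
import Literature.NumberTheory.QuadraticFields.SquareRootGenerator
import Mathlib.NumberTheory.NumberField.Discriminant.Different
import HarnessLib

/-!
# Route `CMKolyvaginAtInertTwo`, crux `CMKolyvaginExactAtInertTwo` (stmt-BirchSwinnertonDyer-24277):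
# the two PLUMBING binders (tower) and (desc-fin) of the over-`ℚ` `2`-descent, DISCHARGED

Seat `bsd-print-cf2-ty2` (TYPER ty2: the discharge interface, Summits side; cell `bsd-print-cf2`).
THEOREMS ONLY (no `def`, no named fact, no `sorry`); no item is closed; BSD is not proved by this.

The `M₀ = 0` case of the crux on the habitat `H₂` for a prime Heegner field
(`Theorems/CMKolyvaginAtInertTwoRationalDescentAtTwoDual.lean`,
`KolyvaginRatDescentTwo.selmer_two_eq_zero_or_eq_kummer_of_cmInert_prime_discr_of_plumbing`, seat
`bsd-line-cmk2-p1` g8) is a theorem modulo two print facts, ty2's Kolyvagin data `D`, `R`, and two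
plumbing binders, whose exact types are (level `n = 2 = 2 ^ 1`; here any `n : ℤ`):

* `htower : ∀ (w : HeightOneSpectrum (𝓞 K)) (ξ : galH1Torsion W n),
    ξ ∈ W.torsionLocalKer ((w.under (𝓞 ℚ)).adicCompletion ℚ) n →
      resTorsion W K n ξ ∈ (W.baseChange K).torsionLocalKer (w.adicCompletion K) n`;
* `hdescfin : ∀ (ξ : galH1Torsion W n) (v : HeightOneSpectrum (𝓞 ℚ)), v ≠ u →
    (∀ w : HeightOneSpectrum (𝓞 K), w.under (𝓞 ℚ) = v →
      resTorsion W K n ξ ∈ selmerLocalKer (W.baseChange K) (w.adicCompletion K) n) →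
    ξ ∈ selmerLocalKer W (v.adicCompletion ℚ) n`
  (`u` the place of `ℚ` below the one ramified prime `q`, `d_K = −q`).

This file DISCHARGES both:

* `htower` — for every number field `K`, every `W/ℚ`, every `n`: the Literature theorem
  `resTorsion_mem_torsionLocalKer_of_under` (`TorsionLocalKernelRestrictionProofs`: the torsion
  twin of `ShaRestriction`'s tower lemmas, with the embedding-independence of `torsionLocalKer`).
* `hdescfin_of_heegner_prime_discr` — for `W/ℚ` elliptic (any model), `K` imaginary
  quadratic with `d_K = −q` (`q` prime), the Heegner hypothesis for `N_W`, and `u ∣ q`: at every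
  `v ≠ u` the local Selmer condition descends from the places `w ∣ v` of `K` to `v`. Mechanism
  (`mem_selmerLocalKer_of_forall_under`): the Selmer condition of `res ξ` at `w` is the vanishing of
  `ξ ↦ c ∈ H¹(ℚ, E)` in `H¹(K_w, E)` (`mem_selmerLocalKer_iff_torsionH1ToH1_mem`,
  `torsionH1ToH1_resTorsion`, `mem_localRestrictionKer_iff_resBaseChange_mem`), and `c` dies in
  `H¹(ℚ_v, E)` by the EXACT local descent of `LocalRestrictionUnramifiedDescentProofs`: `v ≠ u` is
  unramified in `K` (`v ∤ d_K`, Dedekind; Mathlib `NumberField.not_dvd_discr_iff_forall_mem`), so at a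
  place of good reduction Milne *ADT* I.3.8 applies (`mem_localRestrictionKer_adicCompletion_of_isUnramifiedIn`),
  and at a bad place `v ∣ N_W` the Heegner hypothesis says `v` splits
  (`mem_localRestrictionKer_adicCompletion_of_ncard_primesOver_eq`; the currency bridge
  `(p).primesOver = v.primesOver` is `primesOver_span_eq_primesOver_asIdeal`).
* `hdescfin_two_pow_one` / `htower_two_pow_one` — the binders VERBATIM at the consumer's level
  `((2 ^ 1 : ℕ) : ℤ)`.

TO THE CONSUMER (any seat holding 24277): in `…RationalDescentAtTwoDual`,
`htower := RationalDescentPlumbing.htower_two_pow_one W K` and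
`hdescfin := RationalDescentPlumbing.hdescfin_two_pow_one W hK hH hq hd u hu`.

References: [MilneADT2006] I Prop. 3.8, §6; [SerreGaloisCohomology1997] I.§2.4, II.§1.1;
[NeukirchANT1999] I §8–§9, III (2.12); [GrossLMS1991] §§5–6; [McCallumLMS1991] §§2–3.
-/

set_option autoImplicit false

noncomputable section

open scoped Classical

namespace Summit.BirchSwinnertonDyer.Rank1Residual.P2.RationalDescentPlumbing

open WeierstrassCurve NumberField IsDedekindDomain Field
open Literature.NumberTheory.EllipticCurves Literature.NumberTheory.GaloisRepresentations
open Rat.HeightOneSpectrum (primesEquiv natGenerator)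

/-! ## §1 (tower) -/

/-- **(tower), discharged for every number field `K`, every `W/ℚ`, every level `n`**: strict local
vanishing at `ℚ_v` (`v = w ∩ ℚ`) passes to strict local vanishing of `res ξ` at `K_w` — the
Literature theorem `resTorsion_mem_torsionLocalKer_of_under`.
[cite: SerreGaloisCohomology1997, I.§2.4 and II.§1.1] -/
theorem htower (W : WeierstrassCurve ℚ) (K : Type) [Field K] [NumberField K] (n : ℤ) :
    ∀ (w : HeightOneSpectrum (𝓞 K)) (ξ : galH1Torsion W n),
      ξ ∈ W.torsionLocalKer ((w.under (𝓞 ℚ)).adicCompletion ℚ) n →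
        resTorsion W K n ξ ∈ (W.baseChange K).torsionLocalKer (w.adicCompletion K) n :=
  fun w _ hξ ↦ resTorsion_mem_torsionLocalKer_of_under W K n w hξ

/-! ## §2 From `H¹(K, E)`-descent at the completions to the Selmer local condition -/

section Selmer

variable {K L : Type} [Field K] [NumberField K] [Field L] [NumberField L] [Algebra K L]

omit [NumberField K] [NumberField L] in
/-- There is a place of `L` above every finite place of `K` (lying over for the integral extension
`𝓞 L / 𝓞 K`). [cite: NeukirchANT1999, Ch. I §8 (8.1)] -/
theorem exists_under_eq (v : HeightOneSpectrum (𝓞 K)) :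
    ∃ w : HeightOneSpectrum (𝓞 L), w.under (𝓞 K) = v := by
  obtain ⟨⟨P, hP, hPv⟩⟩ := (inferInstance : Nonempty (v.asIdeal.primesOver (𝓞 L)))
  haveI := hP
  haveI := hPv
  have hne : P ≠ ⊥ := Ideal.ne_bot_of_liesOver_of_ne_bot v.ne_bot P
  refine ⟨⟨P, hP, hne⟩, HeightOneSpectrum.ext ?_⟩
  rw [HeightOneSpectrum.under_asIdeal]
  exact hPv.over.symm

/-- **Selmer local conditions descend when `H¹(K, E)`-classes do.** For number fields `K ⊆ L`,
`W/K`, a finite place `v` of `K` such that every class of `H¹(K, E)` dying in `H¹(L_w, E)` for a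
place `w ∣ v` dies in `H¹(K_v, E)`, and `ξ ∈ H¹(K, E[n])` whose restriction `res ξ ∈ H¹(L, E_L[n])`
satisfies the Selmer local condition at every `w ∣ v`: then `ξ` satisfies it at `v`. (The Selmer
condition of `res ξ` at `w` is the vanishing of `ξ ↦ c ∈ H¹(K, E)` in `H¹(L_w, E)`:
`mem_selmerLocalKer_iff_torsionH1ToH1_mem`, `torsionH1ToH1_resTorsion`,
`mem_localRestrictionKer_iff_resBaseChange_mem`.) [cite: MilneADT2006, I.§6]
[cite: SerreGaloisCohomology1997, I.§2.4] -/
theorem mem_selmerLocalKer_of_forall_under (W : WeierstrassCurve K) (n : ℤ)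
    (v : HeightOneSpectrum (𝓞 K))
    (hdesc : ∀ (w : HeightOneSpectrum (𝓞 L)) [w.asIdeal.LiesOver v.asIdeal] (x : W.galH1),
      x ∈ W.localRestrictionKer (w.adicCompletion L) → x ∈ W.localRestrictionKer (v.adicCompletion K))
    {ξ : galH1Torsion W n}
    (hξ : ∀ w : HeightOneSpectrum (𝓞 L), w.under (𝓞 K) = v →
      resTorsion W L n ξ ∈ selmerLocalKer (W.baseChange L) (w.adicCompletion L) n) :
    ξ ∈ selmerLocalKer W (v.adicCompletion K) n := by
  obtain ⟨w, hw⟩ := exists_under_eq (L := L) v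
  haveI : w.asIdeal.LiesOver v.asIdeal := ⟨by rw [← hw, HeightOneSpectrum.under_asIdeal]⟩
  have h := hξ w hw
  rw [WeierstrassCurve.mem_selmerLocalKer_iff_torsionH1ToH1_mem, torsionH1ToH1_resTorsion,
    ← mem_localRestrictionKer_iff_resBaseChange_mem] at h
  rw [WeierstrassCurve.mem_selmerLocalKer_iff_torsionH1ToH1_mem]
  exact hdesc w _ h

end Selmer

/-! ## §3 Bookkeeping over `ℚ`: places, the currencies of `primesOver`, unramified places -/

section Rat

variable {K : Type} [Field K] [NumberField K]

/-- Two finite places of `ℚ` over the same rational prime coincide. [cite: NeukirchANT1999, Ch. I §8] -/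
theorem eq_of_primesEquiv_eq {v v' : HeightOneSpectrum (𝓞 ℚ)}
    (h : (primesEquiv v : ℕ) = (primesEquiv v' : ℕ)) : v = v' :=
  primesEquiv.injective (Subtype.ext h)

/-- **The two currencies of "primes of `𝓞 K` above `p`" agree**: for the finite place `v` of `ℚ`
over `p`, the primes of `𝓞 K` over `(p) ⊂ ℤ` (the currency of `SatisfiesHeegnerHypothesis`) are
the primes over `v ⊂ 𝓞 ℚ` (the currency of Mathlib's `e f g` identity over `𝓞 ℚ`).
[cite: NeukirchANT1999, Ch. I §8 Prop. (8.2)] -/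
theorem primesOver_span_eq_primesOver_asIdeal (v : HeightOneSpectrum (𝓞 ℚ)) {p : ℕ}
    (hv : (primesEquiv v : ℕ) = p) :
    (Ideal.span {(p : ℤ)}).primesOver (𝓞 K) = v.asIdeal.primesOver (𝓞 K) := by
  have hp : p.Prime := hv ▸ (primesEquiv v).2
  -- `n ∈ v' ↔ p_{v'} ∣ n` (Mathlib `Rat.HeightOneSpectrum.natGenerator_dvd_iff`, through `𝓞 ℚ ≃ ℤ`)
  have key : ∀ (v' : HeightOneSpectrum (𝓞 ℚ)) (n : ℕ),
      (n : 𝓞 ℚ) ∈ v'.asIdeal ↔ (primesEquiv v' : ℕ) ∣ n := fun v' n ↦ by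
    rw [show ((primesEquiv v' : Nat.Primes) : ℕ) = natGenerator v' from rfl,
      Rat.HeightOneSpectrum.natGenerator_dvd_iff,
      ← map_natCast (Rat.IsIntegralClosure.intEquiv (𝓞 ℚ)) n, Ideal.apply_mem_of_equiv_iff]
  have hpv : (p : 𝓞 ℚ) ∈ v.asIdeal := (key v p).mpr (hv ▸ dvd_rfl)
  ext P
  constructor
  · rintro ⟨hP, hPover⟩
    haveI := hP
    refine ⟨hP, ⟨?_⟩⟩
    -- `P ∩ 𝓞 ℚ` is a nonzero prime containing `p`, hence the place `v`
    have hpP : ((p : ℕ) : 𝓞 K) ∈ P := natCast_mem_of_liesOver_span hPover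
    set Q : Ideal (𝓞 ℚ) := P.under (𝓞 ℚ) with hQ
    have hpQ : (p : 𝓞 ℚ) ∈ Q := by
      rw [hQ, Ideal.under_def, Ideal.mem_comap, map_natCast]
      exact hpP
    haveI : Q.IsPrime := Ideal.IsPrime.under (𝓞 ℚ) P
    have hQ0 : Q ≠ ⊥ := fun h0 ↦ by
      rw [h0, Ideal.mem_bot] at hpQ
      exact hp.ne_zero (by exact_mod_cast hpQ)
    let v' : HeightOneSpectrum (𝓞 ℚ) := ⟨Q, inferInstance, hQ0⟩
    have hv' : (primesEquiv v' : ℕ) = p :=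
      Nat.prime_dvd_prime_iff_eq (primesEquiv v').2 hp |>.mp
        ((key v' p).mp hpQ)
    have hvv' : v' = v := eq_of_primesEquiv_eq (hv'.trans hv.symm)
    exact (congrArg HeightOneSpectrum.asIdeal hvv').symm
  · rintro ⟨hP, hPover⟩
    haveI := hP
    haveI := hPover
    refine ⟨hP, ?_⟩
    have hne : P ≠ ⊥ := Ideal.ne_bot_of_liesOver_of_ne_bot v.ne_bot P
    have hpP : ((p : ℕ) : 𝓞 K) ∈ P := by
      have h1 : (p : 𝓞 ℚ) ∈ P.under (𝓞 ℚ) := by rw [← hPover.over]; exact hpv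
      rw [Ideal.under_def, Ideal.mem_comap, map_natCast] at h1
      exact h1
    exact liesOver_span_of_natCast_mem_asIdeal hp ⟨P, hP, hne⟩ hpP

/-- **`v ∤ d_K` ⟹ `v` is unramified in `K`** (Dedekind's discriminant theorem, Mathlib
`NumberField.not_dvd_discr_iff_forall_mem`), in the currency `Algebra.IsUnramifiedIn (𝓞 K) v`
over `𝓞 ℚ`. [cite: NeukirchANT1999, Ch. III §2, Cor. (2.12)] -/
theorem isUnramifiedIn_of_not_dvd_discr (v : HeightOneSpectrum (𝓞 ℚ))
    (hnd : ¬ ((primesEquiv v : ℕ) : ℤ) ∣ NumberField.discr K) :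
    Algebra.IsUnramifiedIn (𝓞 K) v.asIdeal := by
  intro P hP hPover
  have hp : Prime ((primesEquiv v : ℕ) : ℤ) := Nat.prime_iff_prime_int.mp (primesEquiv v).2
  have h1 : ((primesEquiv v : ℕ) : 𝓞 ℚ) ∈ v.asIdeal := by
    have key : ∀ n : ℕ, (n : 𝓞 ℚ) ∈ v.asIdeal ↔ (primesEquiv v : ℕ) ∣ n := fun n ↦ by
      rw [show ((primesEquiv v : Nat.Primes) : ℕ) = natGenerator v from rfl,
        Rat.HeightOneSpectrum.natGenerator_dvd_iff,
        ← map_natCast (Rat.IsIntegralClosure.intEquiv (𝓞 ℚ)) n, Ideal.apply_mem_of_equiv_iff]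
    exact (key _).mpr dvd_rfl
  have h2 : (((primesEquiv v : ℕ) : ℤ) : 𝓞 K) ∈ P := by
    have h := h1
    rw [hPover.over, Ideal.under_def, Ideal.mem_comap, map_natCast] at h
    exact_mod_cast h
  haveI := (NumberField.not_dvd_discr_iff_forall_mem K (𝓞 K) hp).mp hnd P hP h2
  exact Algebra.IsUnramifiedAt.of_restrictScalars (R := ℤ) (A := 𝓞 ℚ) P

end Rat

/-! ## §4 (desc-fin) under the Heegner hypothesis with a prime Heegner field -/

section DescFin

variable (W : WeierstrassCurve ℚ) [W.IsElliptic]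
variable {K : Type} [Field K] [NumberField K]

/-- **(desc-fin), discharged.** `W/ℚ` elliptic (any model), `K` imaginary quadratic with
`d_K = −q` (`q` prime) satisfying the Heegner hypothesis for `N_W`, `u` the place of `ℚ` over `q`,
`n` any level. For `ξ ∈ H¹(ℚ, E[n])` and a finite place `v ≠ u` of `ℚ`: if `res ξ ∈ H¹(K, E_K[n])`
satisfies the Selmer local condition at every place `w ∣ v` of `K`, then `ξ` satisfies it at `v`.
Proof: `K = ℚ + ℚ θ` with `θ² = c ∈ ℚ` (`Quadratic.exists_sq_eq_algebraMap`), normal over `ℚ`;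
`v ≠ u` means `p_v ∤ d_K = −q`, so `v` is unramified in `K` (`isUnramifiedIn_of_not_dvd_discr`);
if `W` is good at `v`, `mem_localRestrictionKer_adicCompletion_of_isUnramifiedIn` (Milne *ADT*
I.3.8); if not, `p_v ∣ N_W` (`dvd_conductorNorm_iff`) and the Heegner hypothesis gives two primes
above `p_v`, i.e. `v` splits (`primesOver_span_eq_primesOver_asIdeal`), and
`mem_localRestrictionKer_adicCompletion_of_ncard_primesOver_eq`; conclude with
`mem_selmerLocalKer_of_forall_under`. [cite: MilneADT2006, Ch. I Prop. 3.8 and §6]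
[cite: GrossLMS1991, §1 (Heegner hypothesis) and §6] -/
theorem hdescfin_of_heegner_prime_discr (hK : IsImaginaryQuadratic K)
    (hH : SatisfiesHeegnerHypothesis (W.conductorNorm ℤ) K) {q : ℕ} (hq : q.Prime)
    (hd : NumberField.discr K = -(q : ℤ)) (u : HeightOneSpectrum (𝓞 ℚ))
    (hu : ((primesEquiv u : Nat.Primes) : ℕ) = q) (n : ℤ) :
    ∀ (ξ : galH1Torsion W n) (v : HeightOneSpectrum (𝓞 ℚ)), v ≠ u →
      (∀ w : HeightOneSpectrum (𝓞 K), w.under (𝓞 ℚ) = v →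
        resTorsion W K n ξ ∈ selmerLocalKer (W.baseChange K) (w.adicCompletion K) n) →
      ξ ∈ selmerLocalKer W (v.adicCompletion ℚ) n := by
  intro ξ v hvu hξ
  -- `K = ℚ(θ)`, `θ² = c`, normal over `ℚ`
  have h2 : Module.finrank ℚ K = 2 := hK.1
  obtain ⟨θ, c, hθnot, hθ⟩ := Literature.NumberTheory.QuadraticFields.Quadratic.exists_sq_eq_algebraMap h2
  have hL := Literature.NumberTheory.QuadraticFields.Quadratic.exists_eq_add_mul h2 hθnot
  haveI : Algebra.IsQuadraticExtension ℚ K := ⟨h2⟩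
  haveI : IsGalois ℚ K := inferInstance
  -- `v` is unramified in `K`: `p_v ≠ q`
  have hpv_ne : (primesEquiv v : ℕ) ≠ q := fun h ↦ hvu (eq_of_primesEquiv_eq (h.trans hu.symm))
  have hnd : ¬ ((primesEquiv v : ℕ) : ℤ) ∣ NumberField.discr K := by
    rw [hd, Int.dvd_neg, Int.natCast_dvd_natCast, Nat.prime_dvd_prime_iff_eq (primesEquiv v).2 hq]
    exact hpv_ne
  have hunr : Algebra.IsUnramifiedIn (𝓞 K) v.asIdeal := isUnramifiedIn_of_not_dvd_discr v hnd
  refine mem_selmerLocalKer_of_forall_under W n v (fun w _ x hx ↦ ?_) hξ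
  by_cases hgood : W.HasGoodReductionAt v
  · -- unramified place of good reduction: Milne, ADT I.3.8
    exact mem_localRestrictionKer_adicCompletion_of_isUnramifiedIn W K hθ hL hgood hunr w hx
  · -- bad place: `p_v ∣ N_W`, so `v` splits in `K` (Heegner hypothesis)
    have hdvd : (primesEquiv v : ℕ) ∣ W.conductorNorm ℤ := (W.dvd_conductorNorm_iff v).mpr hgood
    have hsplit : (v.asIdeal.primesOver (𝓞 K)).ncard = Module.finrank ℚ K := by
      rw [← primesOver_span_eq_primesOver_asIdeal v rfl, hH _ (primesEquiv v).2 hdvd, h2]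
    exact mem_localRestrictionKer_adicCompletion_of_ncard_primesOver_eq W K hθ hL hsplit w hx

end DescFin

/-! ## §5 The binders VERBATIM at the consumer's level `2 = 2 ^ 1` -/

section Verbatim

variable (W : WeierstrassCurve ℚ) (K : Type) [Field K] [NumberField K]

/-- `htower` of `…RationalDescentAtTwoDual.ratDescent_dual_of_plumbing` /
`selmer_two_eq_zero_or_eq_kummer_of_cmInert_prime_discr_of_plumbing`, verbatim.
[cite: SerreGaloisCohomology1997, I.§2.4 and II.§1.1] -/
theorem htower_two_pow_one :
    ∀ (w : HeightOneSpectrum (𝓞 K)) (ξ : galH1Torsion W ((2 ^ 1 : ℕ) : ℤ)),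
      ξ ∈ W.torsionLocalKer ((w.under (𝓞 ℚ)).adicCompletion ℚ) ((2 ^ 1 : ℕ) : ℤ) →
        resTorsion W K ((2 ^ 1 : ℕ) : ℤ) ξ ∈
          (W.baseChange K).torsionLocalKer (w.adicCompletion K) ((2 ^ 1 : ℕ) : ℤ) :=
  htower W K _

variable {K} [W.IsElliptic]

/-- `hdescfin` of `…RationalDescentAtTwoDual.ratDescent_dual_of_plumbing` /
`selmer_two_eq_zero_or_eq_kummer_of_cmInert_prime_discr_of_plumbing`, verbatim, from the Heegner
hypothesis with a prime Heegner field. [cite: MilneADT2006, Ch. I Prop. 3.8 and §6] -/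
theorem hdescfin_two_pow_one (hK : IsImaginaryQuadratic K)
    (hH : SatisfiesHeegnerHypothesis (W.conductorNorm ℤ) K) {q : ℕ} (hq : q.Prime)
    (hd : NumberField.discr K = -(q : ℤ)) (u : HeightOneSpectrum (𝓞 ℚ))
    (hu : ((primesEquiv u : Nat.Primes) : ℕ) = q) :
    ∀ (ξ : galH1Torsion W ((2 ^ 1 : ℕ) : ℤ)) (v : HeightOneSpectrum (𝓞 ℚ)), v ≠ u →
      (∀ w : HeightOneSpectrum (𝓞 K), w.under (𝓞 ℚ) = v →
        resTorsion W K ((2 ^ 1 : ℕ) : ℤ) ξ ∈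
          selmerLocalKer (W.baseChange K) (w.adicCompletion K) ((2 ^ 1 : ℕ) : ℤ)) →
      ξ ∈ selmerLocalKer W (v.adicCompletion ℚ) ((2 ^ 1 : ℕ) : ℤ) :=
  hdescfin_of_heegner_prime_discr W hK hH hq hd u hu _

end Verbatim

end Summit.BirchSwinnertonDyer.Rank1Residual.P2.RationalDescentPlumbing

end
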